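import Mathlib

/-!
# The clock of an amplitude cascade: geometric vs lazy (R2 rung, idea-1 gen 3)

HONEST FRAMING: low prior, high value-of-information experiment on Tao's machine paradigm;
NOT a claim that NS blows up.

Pure real analysis, no PDE.  A cascade is recorded by its *level durations* `T n ≥ 0` (time spent
going from level `n` to level `n+1`) and reaches infinitely many levels in finite time iff `T` is
summable.  Two bookkeeping facts behind the rung's instruction "read the pair (r, clock), never r
alone" (HOME/pub-fluidc-idea-1/AMP-PLANE.md §1, CLOCK CAVEAT):

* `summable_of_geometric_clock` : a geometric clock `T (n+1) ≤ c * T n`, `c < 1`, completes in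
  finite time (total time `≤ T 0 / (1 - c)` is the usual bound; we only record summability);
* `not_summable_of_lazy_clock`  : a lazy clock (`T` monotone, `T 0 > 0`) never completes;
* `level_times_unbounded_of_linear_sup_growth` : if the sup velocity obeys an a-priori bound
  `‖u(t)‖_∞ ≤ A (1 + t)` for `t ≥ 0` (axisymmetric no-swirl Euler/NS: Choi–Jeong, arXiv:2110.09079,
  p.10, via Feng–Šverák) and level `n` requires sup velocity `≥ U₀ λ^n` (`λ > 1`: the floor
  `r = g/λ ≥ 1` met at every level means `g ≥ λ`, i.e. velocity growing geometrically), then the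
  level times `t n` tend to `+∞`: such a flow can post `r ≈ 1` at a level, but only on a clock that
  cannot accumulate — it is not a machine;
* `reDyn_ratio_eq` : the sup-twin identity `q = G / Λ` (ratio of the peak structure's Reynolds
  numbers `u²/(ν ω)` over an episode equals sup gain over compression, AMP-PLANE.md §1).

Intended home: `Summits/NavierStokesRegularity/FluidComputer/LazyClock.lean`, companion of
`CirculationLedger.lean` (idea-1 gen 2), p1's `AmplitudeLedger` and p2's `LevelReynoldsFloor`.
Staged by planner seat pub-fluidc-idea-1 (gen 3; HOME/pub-fluidc-idea-1/lean/,
sha16 a1714d89e7c7e065); filed through the gate verbatim (up to this sentence) by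
pub-fluidc-lit gen 34 at idea-1's ASK (HOME STATUS 2026-08-22T22:51Z / 23:21Z).
-/

open Filter Topology

namespace Summit.NavierStokesRegularity.FluidComputer.LazyClock

/-- A geometric clock completes: if `0 ≤ T n`, `T (n+1) ≤ c * T n` with `0 ≤ c < 1`, then `T` is summable. -/
theorem summable_of_geometric_clock {T : ℕ → ℝ} {c : ℝ} (hc0 : 0 ≤ c) (hc1 : c < 1)
    (hT : ∀ n, 0 ≤ T n) (hstep : ∀ n, T (n + 1) ≤ c * T n) : Summable T := by
  have hle : ∀ n, T n ≤ T 0 * c ^ n := by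
    intro n
    induction n with
    | zero => simp
    | succ n ih =>
      calc T (n + 1) ≤ c * T n := hstep n
        _ ≤ c * (T 0 * c ^ n) := by exact mul_le_mul_of_nonneg_left ih hc0
        _ = T 0 * c ^ (n + 1) := by ring
  have hgeom : Summable fun n => T 0 * c ^ n :=
    (summable_geometric_of_lt_one hc0 hc1).mul_left (T 0)
  exact Summable.of_nonneg_of_le hT hle hgeom

/-- A lazy clock never completes: a monotone (non-decreasing) sequence of level durations with
`T 0 > 0` is not summable, so infinitely many levels need infinite time. -/
theorem not_summable_of_lazy_clock {T : ℕ → ℝ} (h0 : 0 < T 0) (hmono : Monotone T) :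
    ¬ Summable T := by
  intro hs
  have hlim : Tendsto T atTop (𝓝 0) := hs.tendsto_atTop_zero
  have hge : ∀ n, T 0 ≤ T n := fun n => hmono (Nat.zero_le n)
  -- eventually T n < T 0, contradiction
  have hev : ∀ᶠ n in atTop, T n < T 0 := (tendsto_order.1 hlim).2 (T 0) h0
  obtain ⟨n, hn⟩ := hev.exists
  exact absurd (hge n) (not_le.mpr hn)

/-- More generally: level durations bounded below by a positive constant are not summable. -/
theorem not_summable_of_durations_ge {T : ℕ → ℝ} {δ : ℝ} (hδ : 0 < δ) (hge : ∀ n, δ ≤ T n) :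
    ¬ Summable T := by
  intro hs
  have hlim : Tendsto T atTop (𝓝 0) := hs.tendsto_atTop_zero
  have hev : ∀ᶠ n in atTop, T n < δ := (tendsto_order.1 hlim).2 δ hδ
  obtain ⟨n, hn⟩ := hev.exists
  exact absurd (hge n) (not_le.mpr hn)

/-- Under an a-priori linear-in-time bound on the sup velocity (axisymmetric no-swirl flows),
a cascade whose `n`-th level needs sup velocity at least `U₀ * lam ^ n` (`lam > 1`, `U₀ > 0`)
has level times `t n → +∞`: the levels cannot accumulate at a finite time. -/
theorem level_times_unbounded_of_linear_sup_growth
    {usup : ℝ → ℝ} {A U₀ lam : ℝ} (hA : 0 < A) (hU : 0 < U₀) (hlam : 1 < lam)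
    (hbound : ∀ s, 0 ≤ s → usup s ≤ A * (1 + s))
    {t : ℕ → ℝ} (ht : ∀ n, 0 ≤ t n) (hlevel : ∀ n, U₀ * lam ^ n ≤ usup (t n)) :
    Tendsto t atTop atTop := by
  -- t n ≥ U₀ lam^n / A - 1, and the right-hand side tends to +∞
  have hlow : ∀ n, U₀ / A * lam ^ n - 1 ≤ t n := by
    intro n
    have h1 : U₀ * lam ^ n ≤ A * (1 + t n) := le_trans (hlevel n) (hbound (t n) (ht n))
    have h2 : U₀ / A * lam ^ n ≤ 1 + t n := by
      rw [div_mul_eq_mul_div, div_le_iff₀ hA]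
      linarith [h1]
    linarith
  have hpow : Tendsto (fun n : ℕ => lam ^ n) atTop atTop := tendsto_pow_atTop_atTop_of_one_lt hlam
  have hc : 0 < U₀ / A := div_pos hU hA
  have hmain : Tendsto (fun n : ℕ => U₀ / A * lam ^ n - 1) atTop atTop := by
    have := (hpow.const_mul_atTop hc)
    exact tendsto_atTop_add_const_right atTop (-1) this |>.congr (fun n => by ring)
  exact tendsto_atTop_mono hlow hmain

/-- The sup-twin identity of AMP-PLANE.md §1: with `Re_dyn = u² / (ν ω)`, the ratio of the peak
structure's Reynolds numbers over an episode equals (sup gain) / (compression),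
`q = G / Λ` where `G = u₂/u₁` and `Λ = (u₁/ω₁)/(u₂/ω₂)`. -/
theorem reDyn_ratio_eq {u₁ u₂ ω₁ ω₂ ν : ℝ} (hu₁ : 0 < u₁) (hu₂ : 0 < u₂) (hω₁ : 0 < ω₁)
    (hω₂ : 0 < ω₂) (hν : 0 < ν) :
    (u₂ ^ 2 / (ν * ω₂)) / (u₁ ^ 2 / (ν * ω₁)) = (u₂ / u₁) / ((u₁ / ω₁) / (u₂ / ω₂)) := by
  field_simp

/-- Consequence used in the rung reading: the Reynolds ratio is `≥ 1` iff the sup gain is at least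
the compression (`α ≥ 1` in the notation of AMP-PLANE.md), for positive data. -/
theorem one_le_reDyn_ratio_iff {u₁ u₂ ω₁ ω₂ ν : ℝ} (hu₁ : 0 < u₁) (hu₂ : 0 < u₂) (hω₁ : 0 < ω₁)
    (hω₂ : 0 < ω₂) (hν : 0 < ν) :
    1 ≤ (u₂ ^ 2 / (ν * ω₂)) / (u₁ ^ 2 / (ν * ω₁)) ↔ (u₁ / ω₁) / (u₂ / ω₂) ≤ u₂ / u₁ := by
  rw [reDyn_ratio_eq hu₁ hu₂ hω₁ hω₂ hν]
  have hΛ : 0 < (u₁ / ω₁) / (u₂ / ω₂) := by positivity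
  rw [one_le_div hΛ]

end Summit.NavierStokesRegularity.FluidComputer.LazyClock
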